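import Mathlib.Data.Nat.Totient
import Mathlib.Data.ZMod.Basic
import Mathlib.Tactic.Ring
import Mathlib.Tactic.NormNum
import Mathlib.Tactic.Linarith
import HarnessLib

set_option linter.dupNamespace false

/-!
# Weil-type family coverage — TYPE-III WINDOWS, part G (census block b04.21 P.S.): the ARITHMETIC SKELETON of THEOREM S23 (vanishing at split primes) and REMARK D

research route conditional on HC_CM; not a corollary; Q11.4-sentence-2 already refuted in dim ≥ 3.

Ring 2, WEIL-TYPE FAMILY-COVERAGE CENSUS (`HOME/WEIL-FAMILY-COVERAGE.md` `## b04`, block b04.21 and its P.S., owner ring2-b04, gen 57; theory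
note `HOME/pub-hodge-ring2-b04/census-g57/theory/THEOREMS-S22.md` §6).  SETTING (informal, not formalised): THEOREM S23 says that the local
Witt term `u_ℓ(c)` of a branch class `c` of odd order `n` VANISHES at every odd split prime `ℓ ∤ n` such that, for each `d | n` carrying
eigenvalues, the subgroup `⟨ℓ mod d⟩ ⊂ (ℤ/d)^×` avoids `−1` (all places of `ℚ(ζ_d)⁺` over `ℓ` split in `ℚ(ζ_d)`, so every CM piece of the
cyclic reduction is metabolic before induction); REMARK D says that for odd-order classes ring2-b02's discriminant character is a product of
prime fundamental discriminants, `d(c) = ∏_p (p^*)^{e_p(c)}`, `p^* = (−1)^{(p−1)/2}p`, because `w(c) = Σ_{d|n} a_d φ(d)/2 ≡ Σ_p e_p(c)(p−1)/2 (mod 2)`.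
THIS FILE checks in the kernel: (1) the two totient parities behind REMARK D — `4 ∣ φ(p^{j+1}) − (p−1)` for an odd prime `p`, and `4 ∣ φ(mn)`
for coprime `m, n > 2` —; (2) the prime discriminants of the carriers of record (`5^* = 5`, `7^* = −7`, `11^* = −11`, `13^* = 13`, `3^* = −3`);
(3) the residue-class certificates of the S23 instances used in the census: `⟨11 mod 7⟩ = {1,4,2} ∌ −1` (`u_{11}(7A) = 0` for `SL₂(7)`: the fit's
`σ_{11}(7A) = σ_{11}(7B) = +1`), `⟨3 mod 13⟩ = {1,3,9} ∌ −1` (`u_3(13X) = 0` for `SL₂(13)`), `⟨7 mod 9⟩ ∌ −1`, `⟨13 mod 9⟩ ∌ −1` (`Sp₄(3)`'s classes of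
order 9 at 7, 13), `5 ≡ −1 (mod 3)` (the inert case: `σ_5(3A) = −1` for `2I` is NOT forced), and `7 ≡ 13 ≡ 1 (mod 3)`, `11 ≡ 1 (mod 5)`; (4) the
additive bookkeeping «all right-hand sides zero ⇒ the unique solution is zero» is `twistLaw_additive_vanishes_of_exponent` of part F.

No `def`, no named fact, no `sorry`; nothing here is a statement about Hodge classes; `HC_CM` is used nowhere.
-/

namespace Summit.HodgeConjecture.HodgeConjecture.Ring2.WeilCoverage

/-- REMARK D, prime-power parity (census b04.21 P.S.): for an odd prime `p` and `j ≥ 1`, `φ(p^{j+1}) − (p − 1) = (p−1)(p^j − 1)` is divisible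
by 4 — so the pieces `d = p^{j+1}` contribute `a_d φ(d)/2 ≡ a_d (p−1)/2 (mod 2)` to `w(c)`.
research route conditional on HC_CM; not a corollary; Q11.4-sentence-2 already refuted in dim ≥ 3. -/
theorem remarkD_totient_prime_pow (p j : ℕ) (hp : p.Prime) (hodd : Odd p) (hj : 1 ≤ j) :
    4 ∣ Nat.totient (p ^ (j + 1)) - (p - 1) := by
  rw [Nat.totient_prime_pow hp (by omega)]
  simp only [Nat.add_sub_cancel]
  -- p^j * (p-1) - (p-1) = (p^j - 1) * (p - 1)
  have h1 : p ^ j * (p - 1) - (p - 1) = (p ^ j - 1) * (p - 1) := by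
    have hpj : 1 ≤ p ^ j := Nat.one_le_pow _ _ hp.pos
    rw [Nat.sub_mul, one_mul]
  rw [h1]
  obtain ⟨a, ha⟩ : Even (p - 1) := by
    obtain ⟨k, hk⟩ := hodd; exact ⟨k, by omega⟩
  obtain ⟨b, hb⟩ : Even (p ^ j - 1) := by
    have : Odd (p ^ j) := hodd.pow
    obtain ⟨k, hk⟩ := this; exact ⟨k, by omega⟩
  rw [ha, hb]
  exact ⟨a * b, by ring⟩

/-- REMARK D, two-prime parity (census b04.21 P.S.): for coprime `m, n > 2`, `4 ∣ φ(mn)` — so the pieces `d` with two distinct odd prime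
factors contribute `a_d φ(d)/2 ≡ 0 (mod 2)` to `w(c)`; together with the prime-power parity: `w(c) ≡ Σ_p e_p(c)(p−1)/2`, i.e.
`d(c) = ∏_p (p^*)^{e_p(c)}` for every class of odd order.
research route conditional on HC_CM; not a corollary; Q11.4-sentence-2 already refuted in dim ≥ 3. -/
theorem remarkD_totient_two_primes (m n : ℕ) (hm : 2 < m) (hn : 2 < n) (hco : Nat.Coprime m n) :
    4 ∣ Nat.totient (m * n) := by
  rw [Nat.totient_mul hco]
  obtain ⟨a, ha⟩ := Nat.totient_even hm
  obtain ⟨b, hb⟩ := Nat.totient_even hn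
  rw [ha, hb]
  exact ⟨a * b, by ring⟩

/-- REMARK D on the carriers of record (census b04.21 P.S.): the prime fundamental discriminants `p^* = (−1)^{(p−1)/2}·p` that make up
`d(c)` for the odd-order classes of the tables — `d(5A) = 5`, `d(7A) = −7`, `d(11A) = −11`, `d(13A) = 13` (one orbit each), `d(3A) = (−3)^{e_3}`.
research route conditional on HC_CM; not a corollary; Q11.4-sentence-2 already refuted in dim ≥ 3. -/
theorem remarkD_prime_discriminants :
    (-1 : ℤ) ^ ((3 - 1) / 2) * 3 = -3 ∧ (-1 : ℤ) ^ ((5 - 1) / 2) * 5 = 5 ∧ (-1 : ℤ) ^ ((7 - 1) / 2) * 7 = -7 ∧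
      (-1 : ℤ) ^ ((11 - 1) / 2) * 11 = -11 ∧ (-1 : ℤ) ^ ((13 - 1) / 2) * 13 = 13 := by
  norm_num

/-- THEOREM S23's SPLIT-PRIME CERTIFICATES used in the census (b04.21 P.S.): `⟨11 mod 7⟩ = {1, 4, 2}` does not contain `−1 = 6`
(so `u_{11}(7A) = u_{11}(7B) = 0` for `SL₂(7)` — the fit's `σ_{11}(7A) = σ_{11}(7B) = +1`), `⟨3 mod 13⟩ = {1, 3, 9}` does not contain `−1 = 12`
(`u_3(13A) = u_3(13B) = 0` for `SL₂(13)`), `⟨7 mod 9⟩ = ⟨13 mod 9⟩ = {1, 7, 4}` does not contain `−1 = 8` (the classes of order 9 of `Sp₄(3)`,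
`SL₂(17)`, `SL₂(19)` at 7 and 13), and the split congruences `7 ≡ 13 ≡ 1 (mod 3)`, `11 ≡ 1 (mod 5)`; whereas `5 ≡ −1 (mod 3)` is the INERT case in
which S23 is silent (`σ_5(3A) = −1` for `2I` is a CM computation, b04.20).
research route conditional on HC_CM; not a corollary; Q11.4-sentence-2 already refuted in dim ≥ 3. -/
theorem splitPrimes_residue_certificates :
    ((11 : ZMod 7) ^ 3 = 1 ∧ (11 : ZMod 7) ≠ -1 ∧ (11 : ZMod 7) ^ 2 ≠ -1) ∧
    ((3 : ZMod 13) ^ 3 = 1 ∧ (3 : ZMod 13) ≠ -1 ∧ (3 : ZMod 13) ^ 2 ≠ -1) ∧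
    ((7 : ZMod 9) ^ 3 = 1 ∧ (7 : ZMod 9) ≠ -1 ∧ (7 : ZMod 9) ^ 2 ≠ -1) ∧
    ((13 : ZMod 9) ^ 3 = 1 ∧ (13 : ZMod 9) ≠ -1 ∧ (13 : ZMod 9) ^ 2 ≠ -1) ∧
    ((7 : ZMod 3) = 1 ∧ (13 : ZMod 3) = 1 ∧ (11 : ZMod 5) = 1 ∧ (5 : ZMod 3) = -1) := by
  refine ⟨⟨by decide, by decide, by decide⟩, ⟨by decide, by decide, by decide⟩, ⟨by decide, by decide, by decide⟩,
    ⟨by decide, by decide, by decide⟩, ⟨by decide, by decide, by decide, by decide⟩⟩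

/-- THE `p ≡ 1 (mod 4)` CERTIFICATES of THEOREM S23 (ii) (census b04.21 P.S.): the central involution's local term `u_ℓ(z)` vanishes at
`ℓ ≡ 1 (mod 4)` (there `ℚ(i)` splits); instances of record `ℓ = 5, 13, 17` (`σ_5(z) = +1` for `2I` and `2.A_6` in the fit, `σ_{13}(z) = +1` for
`SL₂(13)` in the CM run), while `ℓ = 7, 11` are inert (`σ_7(z) = −1` for `SL₂(7)` is NOT forced).
research route conditional on HC_CM; not a corollary; Q11.4-sentence-2 already refuted in dim ≥ 3. -/
theorem splitPrimes_gaussian_certificates :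
    (5 : ZMod 4) = 1 ∧ (13 : ZMod 4) = 1 ∧ (17 : ZMod 4) = 1 ∧ (7 : ZMod 4) = -1 ∧ (11 : ZMod 4) = -1 := by
  refine ⟨by decide, by decide, by decide, by decide, by decide⟩

/-- VANISHING FROM VANISHING RIGHT-HAND SIDES (THEOREM S23 (ii), census b04.21 P.S.): the relation `u(z) = 2•u(q) − w(q,q)` of the cyclic
recurrence with `q² = z`, together with `2 • u(q) = 0` (real class, part E) and `w(q,q) = 0` (metabolic Gaussian piece at `ℓ ≡ 1 (4)`), gives
`u(z) = 0` — stated abstractly.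
research route conditional on HC_CM; not a corollary; Q11.4-sentence-2 already refuted in dim ≥ 3. -/
theorem splitPrimes_central_involution {A : Type*} [AddCommGroup A] (uz uq wqq : A)
    (hrec : wqq = uq + uq - uz) (hreal : (2 : ℕ) • uq = 0) (hmet : wqq = 0) : uz = 0 := by
  rw [two_nsmul] at hreal
  rw [hmet, hreal, zero_sub] at hrec
  exact neg_eq_zero.mp hrec.symm

end Summit.HodgeConjecture.HodgeConjecture.Ring2.WeilCoverage
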